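import Summits.NavierStokesRegularity.NavierStokesRegularity.Theorems.TypeIIInviscidRelaxationCoreExclusionShadowingEnergyClassLoadBearing

/-!
# Cruxes `ColumnarCoreExclusion` (stmt-1966) / `MonopoleCoreExclusion` (stmt-1965), negative side:
# the class-free FLAT-CORE statements contained in both [XL] shadowing stubs are false outside the energy class

`--supports stmt-NavierStokesRegularity-1966` (helper file; theorems only, no definitions, no `sorry`).

`CoreExclusionShadowing` (p833841) isolated the comparison-free statement that BOTH registered shadowing stubs contain
(instantiate the comparison flow at a uniform stream): FLAT CORE ⇒ NO LOCAL BLOW-UP WITHIN THE HORIZON — a classical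
Leray–Hopf solution on `[0,T)` whose slice at time `t` has the core normalisation, the horizon `(T - t)V ≤ KL`, and is
`A·V/K`-close to a CONSTANT on `B(x₀, KL/2)` (resp. to a uniform axial stream `λ·Q e_z` on `B(x₀, KL)`) is bounded on
`[t,T) × B(x₀, 3KL/8)` (resp. `× B(x₀, KL/2)`).  Being WEAKER than the stubs, the flat-core statements are the sharpest
place to record what a proof must use.  This file proves (companion of
`CoreExclusionShadowingLoadBearing`, p835965, same witness — the axial drift `u = -log(1 - t) e_z` of the parasitic
family of Koch–Nadirashvili–Seregin–Šverák, whose slice at `t = 1/2` IS the constant `log 2 · e_z` on all of `ℝ³`):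

* `axial_drift_defeats_flatCore` / `axial_drift_defeats_flatAxialCore` — at every level `K ≥ 1`, every `A > 0`, the
  body of the flat-core statement with `IsLerayHopfOn` replaced by [weak formulation ∧ Type-I rate ∧ closed-sub-slab
  bounds ∧ axisymmetric slices] is refuted (`ν = 1`, `T = 1`, `t = 1/2`, `x₀ = 0`, `V = log 2`, `L = K/V + K`,
  constant `c = u(1/2)`, closeness error `0`).
* `flatCore_false_without_lerayHopf`, `flatCore_false_without_energy`, `flatAxialCore_false_without_lerayHopf`,
  `flatAxialCore_false_without_energy` — the flat-core statements with the Leray–Hopf clause DELETED, resp. WEAKENED to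
  the pressure-free weak formulation `IsWeakNSSolutionOn T ν 0 (u 0) u`, are FALSE.

Reading: "a flat core does not blow up within `K` turnovers" is not a local fact about smooth Navier–Stokes flows — a
harmonic (here linear) pressure accelerates an exactly uniform core inside every ball; only the global energy class
`u(s) ∈ L²(ℝ³)` excludes it.  Nothing here closes an item; no stub is proved or refuted as registered.
[cite: KochNadirashviliSereginSverak2009, §1 p. 3 (parasitic solutions)]
-/

noncomputable section

open MeasureTheory Set Function Filter Metric
open scoped Topology
open Literature.Analysis.FluidPDE
open Summit.NavierStokesRegularity.NavierStokesRegularity.Theorems.Target.Negative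
open Summit.NavierStokesRegularity.NavierStokesRegularity.Theorems.OneSidedRadialCriterionLoadBearing
open Summit.NavierStokesRegularity.NavierStokesRegularity.Theorems.CoreExclusionShadowingLoadBearing

namespace Summit.NavierStokesRegularity.NavierStokesRegularity.Theorems.CoreExclusionFlatCoreLoadBearing

-- the problem directory repeats the summit name (`NavierStokesRegularity/NavierStokesRegularity`)
set_option linter.dupNamespace false

/-! ## §1 Flat core (columnar shape, 1966) -/

/-- **The axial drift defeats the body of the flat-core statement at every level** once `IsLerayHopfOn` is replaced
by [weak formulation ∧ Type-I rate ∧ closed-sub-slab bounds ∧ axisymmetric slices]: at `t = 1/2` the slice IS the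
constant `c = log 2 · e_z` (closeness error `0` on every ball), yet `‖u(s, 0)‖ = -log(1 - s) → ∞`. -/
theorem axial_drift_defeats_flatCore {A K : ℝ} (hA : 0 < A) (hK : 1 ≤ K)
    (h : ∀ (ν T t : ℝ) (u : ℝ → EuclideanSpace ℝ (Fin 3) → EuclideanSpace ℝ (Fin 3))
        (p : ℝ → EuclideanSpace ℝ (Fin 3) → ℝ),
        0 < ν → 0 < T → IsClassicalNSSolutionOn (Ico 0 T) ν 0 u p → IsWeakNSSolutionOn T ν 0 (u 0) u →
        IsTypeIBlowup u T → (∀ T' < T, ∃ M : ℝ, ∀ s ∈ Icc 0 T', ∀ x, ‖u s x‖ ≤ M) →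
        (∀ s ∈ Ico 0 T, IsAxisymmetric (u s)) →
        HasRapidSpatialDecay (u 0) → 0 < t → t < T →
        ∀ (x₀ : EuclideanSpace ℝ (Fin 3)) (L V : ℝ) (c : EuclideanSpace ℝ (Fin 3)),
          0 < L → 0 < V → (∀ x, ‖u t x‖ ≤ V) →
          (∃ x₁, dist x₁ x₀ ≤ L ∧ V ≤ 2 * ‖u t x₁‖) → K * ν ≤ L * V → (T - t) * V ≤ K * L →
          (∀ x ∈ ball x₀ (K * L / 2), ‖u t x - c‖ ≤ A * V / K) →
          ∃ M : ℝ, ∀ s ∈ Ico t T, ∀ x ∈ ball x₀ (3 * K * L / 8), ‖u s x‖ ≤ M) : False := by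
  set V : ℝ := driftAmp (1 / 2) with hVdef
  have hV : 0 < V := driftAmp_half_pos
  have hV1 : V < 1 := driftAmp_half_lt_one
  have hK0 : 0 < K := one_pos.trans_le hK
  have hL : 0 < K / V + K := coreLength_pos hK hV
  set c : EuclideanSpace ℝ (Fin 3) := V • (EuclideanSpace.single (2 : Fin 3) (1 : ℝ)) with hcdef
  have hslice : ∀ x : EuclideanSpace ℝ (Fin 3),
      uniformVel driftAmp (EuclideanSpace.single (2 : Fin 3) (1 : ℝ)) (1 / 2) x = c := fun _ => rfl
  have hnorm : ∀ x : EuclideanSpace ℝ (Fin 3),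
      ‖uniformVel driftAmp (EuclideanSpace.single (2 : Fin 3) (1 : ℝ)) (1 / 2) x‖ = V := fun x =>
    norm_axial_drift ⟨by norm_num, by norm_num⟩ x
  have hconcl := h 1 1 (1 / 2) _ _ one_pos one_pos (isClassical_axial_drift 1) (isWeak_axial_drift 1)
    isTypeIBlowup_axial_drift bounded_subslab_axial_drift (fun s _ => isAxisymmetric_axial_drift s)
    hasRapidSpatialDecay_axial_drift_zero (by norm_num) (by norm_num)
    0 (K / V + K) V c hL hV (fun x => (hnorm x).le)
    ⟨0, by rw [dist_self]; exact hL.le, by rw [hnorm 0]; linarith⟩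
    (reynolds_coreLength hK hV) (horizon_coreLength hK hV hV1)
    (fun x _ => by rw [hslice x, sub_self, norm_zero]; positivity)
  have hr : 0 < 3 * K * (K / V + K) / 8 := by positivity
  exact not_ballBounded_axial_drift (by norm_num) hr 0 hconcl

/-- **The flat-core statement with the Leray–Hopf clause DELETED is FALSE** (everything else as in
`CoreExclusionShadowing.flatCore_of_columnarShadowing`). -/
theorem flatCore_false_without_lerayHopf :
    ¬ (∀ A : ℝ, 0 < A → ∃ K₀ : ℝ, 1 ≤ K₀ ∧ ∀ K : ℝ, K₀ ≤ K →
      ∀ (ν T t : ℝ) (u : ℝ → EuclideanSpace ℝ (Fin 3) → EuclideanSpace ℝ (Fin 3))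
        (p : ℝ → EuclideanSpace ℝ (Fin 3) → ℝ),
        0 < ν → 0 < T → IsClassicalNSSolutionOn (Ico 0 T) ν 0 u p →
        HasRapidSpatialDecay (u 0) → 0 < t → t < T →
        ∀ (x₀ : EuclideanSpace ℝ (Fin 3)) (L V : ℝ) (c : EuclideanSpace ℝ (Fin 3)),
          0 < L → 0 < V → (∀ x, ‖u t x‖ ≤ V) →
          (∃ x₁, dist x₁ x₀ ≤ L ∧ V ≤ 2 * ‖u t x₁‖) → K * ν ≤ L * V → (T - t) * V ≤ K * L →
          (∀ x ∈ ball x₀ (K * L / 2), ‖u t x - c‖ ≤ A * V / K) →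
          ∃ M : ℝ, ∀ s ∈ Ico t T, ∀ x ∈ ball x₀ (3 * K * L / 8), ‖u s x‖ ≤ M) := by
  intro h
  obtain ⟨K₀, hK₀, hK⟩ := h 1 one_pos
  exact axial_drift_defeats_flatCore one_pos hK₀
    (fun ν T t u p hν hT hcl _ _ _ _ hdec ht htT x₀ L V c hL hV hbd hnear hRe hlate hclose =>
      hK K₀ le_rfl ν T t u p hν hT hcl hdec ht htT x₀ L V c hL hV hbd hnear hRe hlate hclose)

/-- **The flat-core statement with the Leray–Hopf clause WEAKENED to the pressure-free weak formulation is FALSE**: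
of the Leray–Hopf bundle exactly the finite-energy clauses are load-bearing. -/
theorem flatCore_false_without_energy :
    ¬ (∀ A : ℝ, 0 < A → ∃ K₀ : ℝ, 1 ≤ K₀ ∧ ∀ K : ℝ, K₀ ≤ K →
      ∀ (ν T t : ℝ) (u : ℝ → EuclideanSpace ℝ (Fin 3) → EuclideanSpace ℝ (Fin 3))
        (p : ℝ → EuclideanSpace ℝ (Fin 3) → ℝ),
        0 < ν → 0 < T → IsClassicalNSSolutionOn (Ico 0 T) ν 0 u p → IsWeakNSSolutionOn T ν 0 (u 0) u →
        HasRapidSpatialDecay (u 0) → 0 < t → t < T →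
        ∀ (x₀ : EuclideanSpace ℝ (Fin 3)) (L V : ℝ) (c : EuclideanSpace ℝ (Fin 3)),
          0 < L → 0 < V → (∀ x, ‖u t x‖ ≤ V) →
          (∃ x₁, dist x₁ x₀ ≤ L ∧ V ≤ 2 * ‖u t x₁‖) → K * ν ≤ L * V → (T - t) * V ≤ K * L →
          (∀ x ∈ ball x₀ (K * L / 2), ‖u t x - c‖ ≤ A * V / K) →
          ∃ M : ℝ, ∀ s ∈ Ico t T, ∀ x ∈ ball x₀ (3 * K * L / 8), ‖u s x‖ ≤ M) := by
  intro h
  obtain ⟨K₀, hK₀, hK⟩ := h 1 one_pos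
  exact axial_drift_defeats_flatCore one_pos hK₀
    (fun ν T t u p hν hT hcl hweak _ _ _ hdec ht htT x₀ L V c hL hV hbd hnear hRe hlate hclose =>
      hK K₀ le_rfl ν T t u p hν hT hcl hweak hdec ht htT x₀ L V c hL hV hbd hnear hRe hlate hclose)

/-! ## §2 Flat axial core (axisymmetric shape, 1965) -/

/-- **The axial drift defeats the body of the flat-AXIAL-core statement at every level** once `IsLerayHopfOn` is
replaced by [weak formulation ∧ Type-I rate ∧ closed-sub-slab bounds ∧ axisymmetric slices]: in the frame `Q = id` the
slice at `t = 1/2` IS the uniform axial stream `log 2 · Q e_z`. -/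
theorem axial_drift_defeats_flatAxialCore {A K : ℝ} (hA : 0 < A) (hK : 1 ≤ K)
    (h : ∀ (ν T t : ℝ) (u : ℝ → EuclideanSpace ℝ (Fin 3) → EuclideanSpace ℝ (Fin 3))
        (p : ℝ → EuclideanSpace ℝ (Fin 3) → ℝ),
        0 < ν → 0 < T → IsClassicalNSSolutionOn (Ico 0 T) ν 0 u p → IsWeakNSSolutionOn T ν 0 (u 0) u →
        IsTypeIBlowup u T → (∀ T' < T, ∃ M : ℝ, ∀ s ∈ Icc 0 T', ∀ x, ‖u s x‖ ≤ M) →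
        (∀ s ∈ Ico 0 T, IsAxisymmetric (u s)) →
        HasRapidSpatialDecay (u 0) → 0 < t → t < T →
        ∀ (x₀ : EuclideanSpace ℝ (Fin 3)) (L V : ℝ)
          (Q : EuclideanSpace ℝ (Fin 3) ≃ₗᵢ[ℝ] EuclideanSpace ℝ (Fin 3)) (c : ℝ),
          0 < L → 0 < V → (∀ x, ‖u t x‖ ≤ V) →
          (∃ x₁, dist x₁ x₀ ≤ L ∧ V ≤ 2 * ‖u t x₁‖) → K * ν ≤ L * V → (T - t) * V ≤ K * L →
          (∀ x ∈ ball x₀ (K * L), ‖u t x - c • Q eZ‖ ≤ A * V / K) →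
          ∃ M : ℝ, ∀ s ∈ Ico t T, ∀ x ∈ ball x₀ (K * L / 2), ‖u s x‖ ≤ M) : False := by
  set V : ℝ := driftAmp (1 / 2) with hVdef
  have hV : 0 < V := driftAmp_half_pos
  have hV1 : V < 1 := driftAmp_half_lt_one
  have hK0 : 0 < K := one_pos.trans_le hK
  have hL : 0 < K / V + K := coreLength_pos hK hV
  have hslice : ∀ x : EuclideanSpace ℝ (Fin 3),
      uniformVel driftAmp (EuclideanSpace.single (2 : Fin 3) (1 : ℝ)) (1 / 2) x =
        V • (LinearIsometryEquiv.refl ℝ (EuclideanSpace ℝ (Fin 3))) eZ := fun _ => rfl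
  have hnorm : ∀ x : EuclideanSpace ℝ (Fin 3),
      ‖uniformVel driftAmp (EuclideanSpace.single (2 : Fin 3) (1 : ℝ)) (1 / 2) x‖ = V := fun x =>
    norm_axial_drift ⟨by norm_num, by norm_num⟩ x
  have hconcl := h 1 1 (1 / 2) _ _ one_pos one_pos (isClassical_axial_drift 1) (isWeak_axial_drift 1)
    isTypeIBlowup_axial_drift bounded_subslab_axial_drift (fun s _ => isAxisymmetric_axial_drift s)
    hasRapidSpatialDecay_axial_drift_zero (by norm_num) (by norm_num)
    0 (K / V + K) V (LinearIsometryEquiv.refl ℝ _) V hL hV (fun x => (hnorm x).le)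
    ⟨0, by rw [dist_self]; exact hL.le, by rw [hnorm 0]; linarith⟩
    (reynolds_coreLength hK hV) (horizon_coreLength hK hV hV1)
    (fun x _ => by rw [hslice x, sub_self, norm_zero]; positivity)
  have hr : 0 < K * (K / V + K) / 2 := by positivity
  exact not_ballBounded_axial_drift (by norm_num) hr 0 hconcl

/-- **The flat-axial-core statement with the Leray–Hopf clause DELETED is FALSE** (everything else as in
`CoreExclusionShadowing.flatAxialCore_of_axisymShadowing`). -/
theorem flatAxialCore_false_without_lerayHopf :
    ¬ (∀ A : ℝ, 0 < A → ∃ K₀ : ℝ, 1 ≤ K₀ ∧ ∀ K : ℝ, K₀ ≤ K →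
      ∀ (ν T t : ℝ) (u : ℝ → EuclideanSpace ℝ (Fin 3) → EuclideanSpace ℝ (Fin 3))
        (p : ℝ → EuclideanSpace ℝ (Fin 3) → ℝ),
        0 < ν → 0 < T → IsClassicalNSSolutionOn (Ico 0 T) ν 0 u p →
        HasRapidSpatialDecay (u 0) → 0 < t → t < T →
        ∀ (x₀ : EuclideanSpace ℝ (Fin 3)) (L V : ℝ)
          (Q : EuclideanSpace ℝ (Fin 3) ≃ₗᵢ[ℝ] EuclideanSpace ℝ (Fin 3)) (c : ℝ),
          0 < L → 0 < V → (∀ x, ‖u t x‖ ≤ V) →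
          (∃ x₁, dist x₁ x₀ ≤ L ∧ V ≤ 2 * ‖u t x₁‖) → K * ν ≤ L * V → (T - t) * V ≤ K * L →
          (∀ x ∈ ball x₀ (K * L), ‖u t x - c • Q eZ‖ ≤ A * V / K) →
          ∃ M : ℝ, ∀ s ∈ Ico t T, ∀ x ∈ ball x₀ (K * L / 2), ‖u s x‖ ≤ M) := by
  intro h
  obtain ⟨K₀, hK₀, hK⟩ := h 1 one_pos
  exact axial_drift_defeats_flatAxialCore one_pos hK₀
    (fun ν T t u p hν hT hcl _ _ _ _ hdec ht htT x₀ L V Q c hL hV hbd hnear hRe hlate hclose =>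
      hK K₀ le_rfl ν T t u p hν hT hcl hdec ht htT x₀ L V Q c hL hV hbd hnear hRe hlate hclose)

/-- **The flat-axial-core statement with the Leray–Hopf clause WEAKENED to the pressure-free weak formulation is
FALSE**: of the Leray–Hopf bundle exactly the finite-energy clauses are load-bearing. -/
theorem flatAxialCore_false_without_energy :
    ¬ (∀ A : ℝ, 0 < A → ∃ K₀ : ℝ, 1 ≤ K₀ ∧ ∀ K : ℝ, K₀ ≤ K →
      ∀ (ν T t : ℝ) (u : ℝ → EuclideanSpace ℝ (Fin 3) → EuclideanSpace ℝ (Fin 3))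
        (p : ℝ → EuclideanSpace ℝ (Fin 3) → ℝ),
        0 < ν → 0 < T → IsClassicalNSSolutionOn (Ico 0 T) ν 0 u p → IsWeakNSSolutionOn T ν 0 (u 0) u →
        HasRapidSpatialDecay (u 0) → 0 < t → t < T →
        ∀ (x₀ : EuclideanSpace ℝ (Fin 3)) (L V : ℝ)
          (Q : EuclideanSpace ℝ (Fin 3) ≃ₗᵢ[ℝ] EuclideanSpace ℝ (Fin 3)) (c : ℝ),
          0 < L → 0 < V → (∀ x, ‖u t x‖ ≤ V) →
          (∃ x₁, dist x₁ x₀ ≤ L ∧ V ≤ 2 * ‖u t x₁‖) → K * ν ≤ L * V → (T - t) * V ≤ K * L →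
          (∀ x ∈ ball x₀ (K * L), ‖u t x - c • Q eZ‖ ≤ A * V / K) →
          ∃ M : ℝ, ∀ s ∈ Ico t T, ∀ x ∈ ball x₀ (K * L / 2), ‖u s x‖ ≤ M) := by
  intro h
  obtain ⟨K₀, hK₀, hK⟩ := h 1 one_pos
  exact axial_drift_defeats_flatAxialCore one_pos hK₀
    (fun ν T t u p hν hT hcl hweak _ _ _ hdec ht htT x₀ L V Q c hL hV hbd hnear hRe hlate hclose =>
      hK K₀ le_rfl ν T t u p hν hT hcl hweak hdec ht htT x₀ L V Q c hL hV hbd hnear hRe hlate hclose)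

end Summit.NavierStokesRegularity.NavierStokesRegularity.Theorems.CoreExclusionFlatCoreLoadBearing

end
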